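import Mathlib
import Summits.ValiantsHypothesis.ValiantsHypothesis.Theorems.LacunarySymmetroidMatrixDescartesCensusDefs
import Summits.ValiantsHypothesis.ValiantsHypothesis.Theorems.LacunarySymmetroidMatrixDescartesStubDescartesCeiling
import Summits.ValiantsHypothesis.ValiantsHypothesis.Theorems.KPlusLogSqLawWeakLiftingTowerGraftDoublingChain
import Summits.ValiantsHypothesis.ValiantsHypothesis.Theorems.KPlusLogSqLawWeakLiftingTowerGraftLawBoundedLetters

/-!
# Tower graft line — EVERY FIXED-LETTER TRUNCATION OF THE SIZE-DOUBLING STUBS S4d / S4f IS A DESCARTES THEOREM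
# (their content, like S5's, is uniformity in `K`)

Calibration file for the line `Cruxes/WeakLifting/Lines/tower_graft.lean` (crux `WeakLifting` = stmt-ValiantsHypothesis-19561),
objects of the registered stubs S4d `stub_sizeDoubling : TowerSizeDoubling` and S4f `stub_sizeDoublingPoly : TowerSizeDoublingPoly`:

* `TowerSizeDoubling := ∃ C, ∀ m K B d, K ≤ m+1 → IsTower (m+1) d → PosRootLawOn (m+1) K B d →
    PosRootLawOn (m+1+m) K (2^C·B + 2^{C·(log₂(m+1))²}) d`,
* `TowerSizeDoublingPoly := ∃ C, ∀ m K B d, 2^C·K ≤ m+1 → IsTower (m+1) d → PosRootLawOn (m+1) K B d →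
    PosRootLawOn (m+1+m) K ((m+2)^C·B + 2^{C·(log₂(m+1))²}) d`.

NO stub is claimed and neither S4d nor S4f is proved: this file proves both bodies with the quantifiers `∃ C ∀ K` WEAKENED to
`∀ K₀ ∃ C ∀ K ≤ K₀` — PARTIAL-RANGE theorems, stated honestly as such (the companion `…TowerGraftLawBoundedLetters.lean` does the same
for S5 `TowerGraftLaw`; this file is its size-induction twin and reuses its arithmetic `choose_succ_letters_le_two_pow` and its
`one_le_of_posRootLawOn_one`).

* `log_two_mul_add_one_le` — `log₂(2m+1) ≤ log₂(m+1) + 1` (arithmetic).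
* `card_posRoots_doubleSize_le_of_bounded_letters (K₀)` — the master inequality with `C = 4K₀(K₀+2)`: for `K ≤ K₀`, on an
  `(m+1)`-tower `d`, `PosRootLawOn (m+1) K B d` ⇒ every symmetric size-`(2m+1)` pencil on `d` has at most `2^C·B + 2^{C·(log₂(m+1))²}`
  positive determinant roots.  Proof: the sparse Descartes ceiling `stub_descartesCeiling` at size `2m+1` (`Z₊ + 1 ≤ C(2m+K, 2m+1)`,
  no symmetry and no tower needed); at `m ≥ 1` the additive term alone pays (`C(2m+1+K, 2m+1) ≤ 2^{K₀(K₀+2)·(log₂(2m+1))²}` and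
  `(log₂(2m+1))² ≤ 4·(log₂(m+1))²`); at `m = 0` (size `1 → 1`) the count is `≤ K − 1` and the factor term pays, because the tower
  hypothesis makes two exponents distinct, whence `B ≥ 1` (`one_le_of_posRootLawOn_one`); `K = 0` is the empty pencil (`posRootLawOn_K_zero`).
* ★ `towerSizeDoubling_bounded_letters (K₀)` — the body of `TowerSizeDoubling` with `K ≤ K₀` inserted, `C = 4K₀(K₀+2)`.
* ★ `towerSizeDoublingPoly_bounded_letters (K₀)` — the body of `TowerSizeDoublingPoly` with `K ≤ K₀` inserted, same `C`
  (`2^C ≤ (m+2)^C`; the fat guard `2^C·K ≤ m+1` is not used).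

READING.  S4d / S4f quantify ONE `C` for ALL `K`; every truncation `K ≤ K₀` is Descartes-zone — so, exactly as for S5, the research content of the
size-induction spine is the UNIFORMITY IN `K` (the window `log₂² m ≲ K ≲ m`), now in the kernel and by name on the binder shapes of S4d / S4f.
The guard `K ≤ m+1` of S4d and the tower hypothesis beyond `m = 0` are idle in this zone.  Nothing here bears on that content.
HONEST FRAMING: Descartes bookkeeping; S4/S4b/S4d/S4f/S5/S5ᴸ, TowerB, `WeakLifting`, Conjecture B, `MatrixDescartes` (18050) untouched; VP ≠ VNP
NOT proved.  Def-free.  Seat: prover leafhand-val-kpluslogsqlaw-1 g2, `--supports stmt-ValiantsHypothesis-19561`.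
-/

-- `Summit.ValiantsHypothesis.ValiantsHypothesis.…` repeats a component by the D-0017 layout
-- (single-conjunct summit), which the `dupNamespace` linter flags; the name is mandated.
set_option linter.dupNamespace false

namespace Summit.ValiantsHypothesis.ValiantsHypothesis.Theorems.KPlusLogSqLaw.TowerGraft

open Polynomial Matrix
open scoped BigOperators Polynomial
open Summit.ValiantsHypothesis.ValiantsHypothesis.Theorems.LacunarySymmetroidMatrixDescartes (PosRootLawOn stub_descartesCeiling)

section SizeDoublingBoundedLetters

/-- `log₂(2m+1) ≤ log₂(m+1) + 1`. [arithmetic] -/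
theorem log_two_mul_add_one_le (m : ℕ) : Nat.log 2 (m + 1 + m) ≤ Nat.log 2 (m + 1) + 1 := by
  calc Nat.log 2 (m + 1 + m) ≤ Nat.log 2 ((m + 1) * 2) := Nat.log_mono_right (by omega)
    _ = Nat.log 2 (m + 1) + 1 := Nat.log_mul_base (by norm_num) (by omega)

/-- **the master inequality of the Descartes zone for size doubling.**  For `K ≤ K₀`, on an `(m+1)`-tower `d` (only used at `m = 0`:
two distinct exponents), the class budget `B` at size `m+1` (only used at `m = 0`: `B ≥ 1`) and `C = 4K₀(K₀+2)`: every symmetric pencil of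
size `2m+1` on `d` has at most `2^C·B + 2^{C·(log₂(m+1))²}` positive determinant roots. [this work; sparse Descartes rule] -/
theorem card_posRoots_doubleSize_le_of_bounded_letters (K₀ : ℕ) {m K B : ℕ} {d : Fin K → ℕ} (hK : K ≤ K₀)
    (hd : ∀ l l' : Fin K, l < l' → (m + 1) * d l < d l') (hB : PosRootLawOn (m + 1) K B d)
    (S : Fin K → Matrix (Fin (m + 1 + m)) (Fin (m + 1 + m)) ℝ) (hS : ∀ l, (S l).IsSymm) :
    ((∑ l, (X : ℝ[X]) ^ d l • (S l).map C).det.roots.toFinset.filter (fun t => 0 < t)).card ≤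
      2 ^ (4 * K₀ * (K₀ + 2)) * B + 2 ^ (4 * K₀ * (K₀ + 2) * Nat.log 2 (m + 1) ^ 2) := by
  rcases Nat.eq_zero_or_pos K with hK0 | hKpos
  · -- no letters: the empty pencil has no roots
    subst hK0
    exact (posRootLawOn_K_zero (m + 1 + m) 0 d S hS).trans (Nat.zero_le _)
  have hdesc := stub_descartesCeiling K (m + 1 + m) hKpos d S
  -- `Z₊ + 1 ≤ C(2m+K, 2m+1)`
  rw [show m + 1 + m + K - 1 = m + m + K by omega] at hdesc
  rcases Nat.eq_zero_or_pos m with hm | hm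
  · -- size `1 → 1`: `Z₊ ≤ K − 1`, paid by the factor term (`B ≥ 1` as soon as `K ≥ 2`)
    subst hm
    have hch : Nat.choose (0 + 0 + K) (0 + 1 + 0) = K := by simp
    rw [hch] at hdesc
    have hadd : 1 ≤ 2 ^ (4 * K₀ * (K₀ + 2) * Nat.log 2 (0 + 1) ^ 2) := Nat.one_le_two_pow
    rcases Nat.lt_or_ge K 2 with hK2 | hK2
    · omega
    · have h01 : d ⟨0, by omega⟩ ≠ d ⟨1, by omega⟩ := by
        have := hd ⟨0, by omega⟩ ⟨1, by omega⟩ (Fin.mk_lt_mk.mpr zero_lt_one)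
        omega
      have hB1 := one_le_of_posRootLawOn_one d _ _ h01 hB
      have hC : K₀ ≤ 2 ^ (4 * K₀ * (K₀ + 2)) := by
        calc K₀ ≤ 2 ^ K₀ := Nat.lt_two_pow_self.le
          _ ≤ 2 ^ (4 * K₀ * (K₀ + 2)) := Nat.pow_le_pow_right (by norm_num) (by nlinarith)
      have hCB : K₀ ≤ 2 ^ (4 * K₀ * (K₀ + 2)) * B := hC.trans (Nat.le_mul_of_pos_right _ hB1)
      omega
  · -- size `m+1 → 2m+1` with `m ≥ 1`: the additive term alone pays
    have h1 : Nat.choose (m + m + K) (m + 1 + m) ≤ Nat.choose (m + 1 + m + K) (m + 1 + m) :=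
      Nat.choose_le_choose _ (by omega)
    have h2 : Nat.choose (m + 1 + m + K) (m + 1 + m) ≤ 2 ^ (K₀ * (K₀ + 2) * Nat.log 2 (m + 1 + m) ^ 2) :=
      choose_succ_letters_le_two_pow (K₀ := K₀) (by omega) hK
    have hL1 : 1 ≤ Nat.log 2 (m + 1) := Nat.le_log_of_pow_le (by norm_num) (by omega)
    have hlog : Nat.log 2 (m + 1 + m) ^ 2 ≤ 4 * Nat.log 2 (m + 1) ^ 2 := by
      have h := log_two_mul_add_one_le m
      nlinarith [h, hL1, Nat.zero_le (Nat.log 2 (m + 1 + m))]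
    have h3 : 2 ^ (K₀ * (K₀ + 2) * Nat.log 2 (m + 1 + m) ^ 2) ≤ 2 ^ (4 * K₀ * (K₀ + 2) * Nat.log 2 (m + 1) ^ 2) := by
      apply Nat.pow_le_pow_right (by norm_num)
      calc K₀ * (K₀ + 2) * Nat.log 2 (m + 1 + m) ^ 2 ≤ K₀ * (K₀ + 2) * (4 * Nat.log 2 (m + 1) ^ 2) :=
            Nat.mul_le_mul_left _ hlog
        _ = 4 * K₀ * (K₀ + 2) * Nat.log 2 (m + 1) ^ 2 := by ring
    have h4 := (hdesc.trans h1).trans (h2.trans h3)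
    omega

/-- **EVERY FIXED-LETTER TRUNCATION OF S4d IS A DESCARTES THEOREM.**  For every `K₀` there is `C` (namely `4K₀(K₀+2)`) such that the body of
`TowerSizeDoubling` holds for all `m, B, d` and all `K ≤ K₀`: passing from size `m+1` to size `2m+1` on an `(m+1)`-tower costs at most
`2^C·B + 2^{C·(log₂(m+1))²}`.  (S4d itself asks for ONE `C` for ALL `K` and is NOT proved here; its guard `K ≤ m+1` is idle in this zone.)
[this work] -/
theorem towerSizeDoubling_bounded_letters (K₀ : ℕ) :
    ∃ C : ℕ, ∀ (m K B : ℕ) (d : Fin K → ℕ), K ≤ K₀ → K ≤ m + 1 → (∀ l l' : Fin K, l < l' → (m + 1) * d l < d l') →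
      PosRootLawOn (m + 1) K B d → PosRootLawOn (m + 1 + m) K (2 ^ C * B + 2 ^ (C * Nat.log 2 (m + 1) ^ 2)) d := by
  refine ⟨4 * K₀ * (K₀ + 2), fun m K B d hK _ hd hB => ?_⟩
  intro S hS
  exact card_posRoots_doubleSize_le_of_bounded_letters K₀ hK hd hB S hS

/-- **EVERY FIXED-LETTER TRUNCATION OF S4f IS A DESCARTES THEOREM.**  For every `K₀` there is `C` (namely `4K₀(K₀+2)`) such that the body of
`TowerSizeDoublingPoly` holds for all `m, B, d` and all `K ≤ K₀` (polynomial factor `(m+2)^C ≥ 2^C`; the fat guard `2^C·K ≤ m+1` is not used).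
(S4f itself asks for ONE `C` for ALL `K` and is NOT proved here.) [this work] -/
theorem towerSizeDoublingPoly_bounded_letters (K₀ : ℕ) :
    ∃ C : ℕ, ∀ (m K B : ℕ) (d : Fin K → ℕ), K ≤ K₀ → 2 ^ C * K ≤ m + 1 → (∀ l l' : Fin K, l < l' → (m + 1) * d l < d l') →
      PosRootLawOn (m + 1) K B d →
      PosRootLawOn (m + 1 + m) K ((m + 2) ^ C * B + 2 ^ (C * Nat.log 2 (m + 1) ^ 2)) d := by
  refine ⟨4 * K₀ * (K₀ + 2), fun m K B d hK _ hd hB => ?_⟩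
  intro S hS
  have h := card_posRoots_doubleSize_le_of_bounded_letters K₀ hK hd hB S hS
  have hfac : 2 ^ (4 * K₀ * (K₀ + 2)) * B ≤ (m + 2) ^ (4 * K₀ * (K₀ + 2)) * B :=
    Nat.mul_le_mul_right _ (Nat.pow_le_pow_left (by omega) _)
  exact h.trans (Nat.add_le_add_right hfac _)

end SizeDoublingBoundedLetters

end Summit.ValiantsHypothesis.ValiantsHypothesis.Theorems.KPlusLogSqLaw.TowerGraft
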